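import Literature.AlgebraicGeometry.ShimuraVarieties.UnitaryBallQuotientDatum
import Mathlib.LinearAlgebra.Matrix.PosDef
import HarnessLib

/-!
# The reflection in a negative line of a hermitian form, and the positivity of `Hc·r_v` from the signature
# (the `H^τ`-component of Deligne's `h(i)` for a unitary Shimura datum; Deligne 1979 Prop. 2.3.10, RSZ 2020 Remark 3.3)

Topic `AlgebraicGeometry/ShimuraVarieties`; namespace `Literature.AlgebraicGeometry.ShimuraVarieties.UnitaryCurve.AuxV`.
Definitions with bodies (`formH`, `projH`, `reflH`) and theorems; no named fact, no instance, no notation, nothing asserted (net debt 0).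
Cell `hodgecm-mathlib` (D-0151), FLOOR 0, P6 «MOD programme», door (E) of `stub_RGD`, organ **E2** «complex structure + period map» (LEAD F0P6-plan (g2)
2026-09-01T21:40:57Z; GEN heir A-p18 (g31) field types (F1)–(F3); census `F0/P6/A-p17/g27/CENSUS-E2-UnitaryCurveAuxiliaryPeriodMap.v1.A-p17g27.md`) =
the rank-`n`, `W₀`-FREE and FRAME-FREE form of ★ `UnitaryAuxiliaryComplexStructure` ∕ `…PeriodEigenrows` ∕ `…PeriodMap` (the case `Fin 1 ⊕ Fin 3` over the
ball model of the hDel I-1′ road, namespace `…UnitaryCanonicalModel.Aux`, kept untouched; everything rank-free there — `realPi`, `realEmb`, `iPhi`, `embOf`,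
the trace formula `Tr_{ℝ⊗M/ℝ} = 2 Re Σ_{ρ∈Φ}` — is REUSED, not re-declared).  Points are read as vectors `v ∈ ℂⁿ` NEGATIVE for `H^τ` (★ `negCone (H.map τ)`:
the currency of ★ `RecordSystemGS.hol`, of the E-line chart `AuxChartGS.Z a : (Fin 2 → ℂ) → …` and of ★ `hasHolomorphicSiegelLift_of_negConeChart`);
the rank-3 frame `T` (`Tᴴ H^τ T = diag(1,1,−1)`) and the ball model are not needed.  `--supports stmt-HodgeConjecture-24832`, count-neutral; HC_CM is
proved only modulo the printed citations until rung 0 closes.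
THIS FILE (E2 FILE A1, pure hermitian linear algebra over `ℂ`, any finite index type `m`): for `Hc : Matrix m m ℂ` and `v : m → ℂ`,
* `formH Hc v = v̄ᵀ Hc v` (= ★ `hermForm (starRingEnd ℂ) Hc v v`), real for hermitian `Hc`, `≠ 0` on ★ `negCone Hc`;
* `projH Hc v = v·(v̄ᵀHc)/(v̄ᵀHc v)` and **`reflH Hc v = 1 − 2·projH`** — the `Hc`-reflection in the line `ℂv` ([RapoportSmithlingZhang2020Diagonal] Remark 3.3:
  the point of `D_{φ₀}` is the negative line, `h_{G,φ₀}(i)` acts by `−1`∕`+1`-type eigenvalues on it and its orthogonal): `r_v² = 1` (unconditionally),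
  `r_vᴴ Hc r_v = Hc`, `r_{c v} = r_v`, `r_v v = −v`, `r_v y = y` for `y ⊥ v`, the ROW facts `d·r_v = d` (`d·v = 0`) and `(v̄ᵀHc)·r_v = −(v̄ᵀHc)`
  (the left-eigenrow census of the period map, sequel FILE B);
* **`star_reflH_mulVec_dotProduct_pos`**: if `v` is negative and `Hc` is positive on the `Hc`-orthogonal of `v` (`hsig` — signature `(n−1, 1)`), then
  `(r_v y)ᴴ Hc y > 0` for `y ≠ 0`, i.e. the hermitian form `Hc·r_v` is POSITIVE DEFINITE — proved directly on `y = a v + y⊥` (the rank-3 twin ★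
  `star_reflFrame_mulVec_dotProduct_pos` went through `U(2,1)`-transitivity of the ball).
The rank-3 ★ `reflJ w` ∕ `reflFrame T w` are `reflH BallModel.J w` ∕ `reflH (H^τ) (T w)`.

## References
* [Deligne1979ShimuraVarieties] P. Deligne, *Variétés de Shimura* (1979), Prop. 2.3.10 and 2.3.9 (PDF p. 32 of Milne's translation).
* [Milne2005ShimuraVarieties] J. S. Milne, *Introduction to Shimura varieties* (2005), §6 pp. 67–70 (`X(ψ)^±`), §8 p. 81 («ψ(Ju, Jv) = ψ(u, v)»).
* [RapoportSmithlingZhang2020Diagonal] M. Rapoport, B. Smithling, W. Zhang, *Arithmetic diagonal cycles on unitary Shimura varieties*, Compos. Math.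
  156 (2020), Remark 3.2 (ii)(iii) pp. 9–10, Remark 3.3 p. 10.
* [Lange2023AbelianVarietiesComplex] H. Lange, *Abelian Varieties over the Complex Numbers* (2023), §7.1.2 (7.1).
* [BergeronMillsonMoeglin2016Balls] N. Bergeron, J. Millson, C. Moeglin, Acta Math. 216 (2016), Part 2 §1.3 (negative lines).
* [Jacobowitz1990] H. Jacobowitz, *An Introduction to CR Structures* (1990), Ch. 2 §1 (reflections for a hermitian form).
-/

set_option autoImplicit false

noncomputable section

open Matrix
open scoped ComplexConjugate ComplexOrder

namespace Literature.AlgebraicGeometry.ShimuraVarieties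

namespace UnitaryCurve

namespace AuxV

/-! ### §1. The reflection in a negative line of a hermitian form (any index type) -/

section Reflection

variable {m : Type} [Fintype m] (Hc : Matrix m m ℂ)

/-- `q(v) = v̄ᵀ Hc v` (= ★ `hermForm (starRingEnd ℂ) Hc v v`). [cite: BergeronMillsonMoeglin2016Balls, Part 2 §1.3] -/
def formH (v : m → ℂ) : ℂ := star v ⬝ᵥ (Hc *ᵥ v)

/-- `formH` is the tree's `hermForm` on the diagonal. [cite: BergeronMillsonMoeglin2016Balls, Part 2 §1.3] -/
theorem formH_eq_hermForm (v : m → ℂ) : formH Hc v = hermForm (starRingEnd ℂ) Hc v v := (hermForm_starRingEnd Hc v v).symm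

/-- On the negative cone `Re q(v) < 0`. [cite: BergeronMillsonMoeglin2016Balls, Part 2 §1.3] -/
theorem formH_re_neg_of_mem_negCone {v : m → ℂ} (hv : v ∈ negCone Hc) : (formH Hc v).re < 0 := by
  rw [mem_negCone_iff] at hv
  exact hv

/-- On the negative cone `q(v) ≠ 0`. [cite: BergeronMillsonMoeglin2016Balls, Part 2 §1.3] -/
theorem formH_ne_zero_of_mem_negCone {v : m → ℂ} (hv : v ∈ negCone Hc) : formH Hc v ≠ 0 := by
  intro h
  have h' := formH_re_neg_of_mem_negCone Hc hv
  rw [h, Complex.zero_re] at h'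
  exact lt_irrefl _ h'

/-- A vector of the negative cone is non-zero. [cite: BergeronMillsonMoeglin2016Balls, Part 2 §1.3] -/
theorem ne_zero_of_mem_negCone {v : m → ℂ} (hv : v ∈ negCone Hc) : v ≠ 0 := by
  intro h
  apply formH_ne_zero_of_mem_negCone Hc hv
  rw [formH, h, Matrix.mulVec_zero, dotProduct_zero]

variable {Hc}

/-- **Hermitian symmetry**: `conj(x̄ᵀ Hc y) = ȳᵀ Hc x` for `Hcᴴ = Hc`. [cite: Jacobowitz1990, Ch. 2 §1 (p. 40)] -/
theorem conj_star_dotProduct_mulVec (hH : Hcᴴ = Hc) (x y : m → ℂ) :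
    conj (star x ⬝ᵥ (Hc *ᵥ y)) = star y ⬝ᵥ (Hc *ᵥ x) := by
  have h : star (star x ⬝ᵥ (Hc *ᵥ y)) = star y ⬝ᵥ (Hc *ᵥ x) := by
    rw [star_dotProduct, star_star, star_mulVec, hH, ← dotProduct_mulVec]
  rw [← h, Complex.star_def]

/-- `q(v)` is real for hermitian `Hc`: `conj q(v) = q(v)`. [cite: Jacobowitz1990, Ch. 2 §1 (p. 40)] -/
theorem conj_formH (hH : Hcᴴ = Hc) (v : m → ℂ) : conj (formH Hc v) = formH Hc v :=
  conj_star_dotProduct_mulVec hH v v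

/-- `Im q(v) = 0` for hermitian `Hc`. [cite: Jacobowitz1990, Ch. 2 §1 (p. 40)] -/
theorem formH_im (hH : Hcᴴ = Hc) (v : m → ℂ) : (formH Hc v).im = 0 :=
  Complex.conj_eq_iff_im.1 (conj_formH hH v)

variable (Hc)

/-- **The `Hc`-orthogonal projection onto the line `ℂv`**: `P_v = v·(v̄ᵀHc)/(v̄ᵀHc v)` (zero if `q(v) = 0`).
[cite: Deligne1979ShimuraVarieties, Prop. 2.3.10 (PDF p. 32)] -/
def projH (v : m → ℂ) : Matrix m m ℂ :=
  (formH Hc v)⁻¹ • Matrix.vecMulVec v (star v ᵥ* Hc)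

variable {v : m → ℂ}

/-- `(v̄ᵀHc)·v = q(v)`. [cite: Jacobowitz1990, Ch. 2 §1 (p. 40)] -/
theorem star_vecMul_dotProduct (v : m → ℂ) : (star v ᵥ* Hc) ⬝ᵥ v = formH Hc v := by
  rw [formH, Matrix.dotProduct_mulVec]

/-- `P_v² = P_v` (for `q(v) = 0` both sides vanish). [cite: Deligne1979ShimuraVarieties, Prop. 2.3.10 (PDF p. 32)] -/
theorem projH_mul_projH (v : m → ℂ) : projH Hc v * projH Hc v = projH Hc v := by
  by_cases hq : formH Hc v = 0
  · rw [projH, hq, _root_.inv_zero, zero_smul, Matrix.mul_zero]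
  rw [projH, Matrix.smul_mul, Matrix.mul_smul, Matrix.vecMulVec_mul_vecMulVec, star_vecMul_dotProduct,
    Matrix.vecMulVec_smul, smul_smul, smul_smul]
  change ((formH Hc v)⁻¹ * (formH Hc v)⁻¹ * formH Hc v) • _ = _
  rw [inv_mul_cancel_right₀ hq]

/-- `P_vᴴ Hc = Hc P_v` (`P_v` is `Hc`-self-adjoint) for hermitian `Hc`. [cite: Deligne1979ShimuraVarieties, Prop. 2.3.10 (PDF p. 32)] -/
theorem conjTranspose_projH_mul (hH : Hcᴴ = Hc) (v : m → ℂ) : (projH Hc v)ᴴ * Hc = Hc * projH Hc v := by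
  rw [projH, Matrix.conjTranspose_smul, Matrix.conjTranspose_vecMulVec, Matrix.star_vecMul, star_star, hH,
    Matrix.smul_mul, Matrix.mul_smul, Matrix.vecMulVec_mul, Matrix.mul_vecMulVec]
  congr 1
  rw [star_inv₀, Complex.star_def, conj_formH hH]

/-- Scaling the vector does not change the projection: `P_{c v} = P_v` for `c ≠ 0`. [cite: Deligne1979ShimuraVarieties, Prop. 2.3.10 (PDF p. 32)] -/
theorem projH_smul {c : ℂ} (hc : c ≠ 0) (v : m → ℂ) : projH Hc (c • v) = projH Hc v := by
  have hq : formH Hc (c • v) = (conj c * c) * formH Hc v := by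
    rw [formH, formH, star_smul, Matrix.mulVec_smul, smul_dotProduct, dotProduct_smul, smul_smul, smul_eq_mul,
      Complex.star_def]
  have hc' : conj c ≠ 0 := (map_ne_zero _).2 hc
  by_cases hw : formH Hc v = 0
  · rw [projH, projH, hq, hw, mul_zero, _root_.inv_zero, zero_smul, zero_smul]
  rw [projH, projH, hq, star_smul, Matrix.smul_vecMul, Complex.star_def, Matrix.smul_vecMulVec,
    Matrix.vecMulVec_smul, smul_smul, smul_smul]
  congr 1
  field_simp

/-- `P_v y = (v̄ᵀHc y / q(v))·v`. [cite: Deligne1979ShimuraVarieties, Prop. 2.3.10 (PDF p. 32)] -/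
theorem projH_mulVec (v y : m → ℂ) : projH Hc v *ᵥ y = ((formH Hc v)⁻¹ * (star v ⬝ᵥ (Hc *ᵥ y))) • v := by
  rw [projH, Matrix.smul_mulVec, Matrix.vecMulVec_mulVec, op_smul_eq_smul, smul_smul, Matrix.dotProduct_mulVec]

variable [DecidableEq m]

variable (v) in
/-- **The `Hc`-reflection in the line `ℂv`**: `r_v = 1 − 2P_v` (`−1` on `ℂv`, `+1` on its `Hc`-orthogonal).
[cite: Deligne1979ShimuraVarieties, Prop. 2.3.10 (PDF p. 32)] [cite: RapoportSmithlingZhang2020Diagonal, Remark 3.3 p. 10] -/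
def reflH : Matrix m m ℂ :=
  1 - (2 : ℂ) • projH Hc v

/-- **`r_v² = 1`** (unconditionally). [cite: Jacobowitz1990, Ch. 2 §1 (p. 40)] -/
theorem reflH_mul_reflH (v : m → ℂ) : reflH Hc v * reflH Hc v = 1 := by
  have hPP := projH_mul_projH Hc v
  simp only [reflH, sub_mul, mul_sub, Matrix.one_mul, Matrix.mul_one, Matrix.smul_mul, Matrix.mul_smul, hPP,
    smul_smul]
  module

/-- `r_vᴴ Hc = Hc r_v` for hermitian `Hc`. [cite: Deligne1979ShimuraVarieties, Prop. 2.3.10 (PDF p. 32)] -/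
theorem conjTranspose_reflH_mul (hH : Hcᴴ = Hc) (v : m → ℂ) : (reflH Hc v)ᴴ * Hc = Hc * reflH Hc v := by
  have h2 : star (2 : ℂ) = 2 := by
    rw [Complex.star_def, ← Complex.ofReal_ofNat, Complex.conj_ofReal]
  rw [reflH, Matrix.conjTranspose_sub, Matrix.conjTranspose_one, Matrix.conjTranspose_smul, h2, Matrix.sub_mul,
    Matrix.one_mul, Matrix.smul_mul, conjTranspose_projH_mul Hc hH, Matrix.mul_sub, Matrix.mul_one, Matrix.mul_smul]

/-- **`r_vᴴ Hc r_v = Hc`**: the reflection is `Hc`-unitary. [cite: Jacobowitz1990, Ch. 2 §1 (p. 40)] -/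
theorem conjTranspose_reflH_mul_mul_reflH (hH : Hcᴴ = Hc) (v : m → ℂ) : (reflH Hc v)ᴴ * Hc * reflH Hc v = Hc := by
  rw [conjTranspose_reflH_mul Hc hH, Matrix.mul_assoc, reflH_mul_reflH, Matrix.mul_one]

/-- `r_{c v} = r_v` for `c ≠ 0` (`r_v` depends on the line `ℂv` only). [cite: Deligne1979ShimuraVarieties, Prop. 2.3.10 (PDF p. 32)] -/
theorem reflH_smul {c : ℂ} (hc : c ≠ 0) (v : m → ℂ) : reflH Hc (c • v) = reflH Hc v := by
  rw [reflH, reflH, projH_smul Hc hc]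

/-- `r_v y = y − (2 v̄ᵀHc y / q(v))·v`. [cite: Deligne1979ShimuraVarieties, Prop. 2.3.10 (PDF p. 32)] -/
theorem reflH_mulVec (v y : m → ℂ) :
    reflH Hc v *ᵥ y = y - ((2 : ℂ) * ((formH Hc v)⁻¹ * (star v ⬝ᵥ (Hc *ᵥ y)))) • v := by
  rw [reflH, Matrix.sub_mulVec, Matrix.one_mulVec, Matrix.smul_mulVec, projH_mulVec, smul_smul]

/-- **`r_v v = −v`** on the negative cone (`q(v) ≠ 0`). [cite: RapoportSmithlingZhang2020Diagonal, Remark 3.3 p. 10] -/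
theorem reflH_mulVec_self (hv : formH Hc v ≠ 0) : reflH Hc v *ᵥ v = -v := by
  rw [reflH_mulVec, ← formH, inv_mul_cancel₀ hv, mul_one, two_smul]
  abel

/-- **`r_v y = y` for `y` `Hc`-orthogonal to `v`** (`v̄ᵀ Hc y = 0`). [cite: RapoportSmithlingZhang2020Diagonal, Remark 3.3 p. 10] -/
theorem reflH_mulVec_of_orthogonal {y : m → ℂ} (h : star v ⬝ᵥ (Hc *ᵥ y) = 0) : reflH Hc v *ᵥ y = y := by
  rw [reflH_mulVec, h, mul_zero, mul_zero, zero_smul, sub_zero]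

/-- **Rows `d` with `d·v = 0` are fixed by `r_v` acting on the right**: `d·r_v = d`. [cite: Deligne1979ShimuraVarieties, Prop. 2.3.10 (PDF p. 32)] -/
theorem vecMul_reflH_of_dotProduct_eq_zero {d : m → ℂ} (h : d ⬝ᵥ v = 0) : d ᵥ* reflH Hc v = d := by
  rw [reflH, projH, Matrix.vecMul_sub, Matrix.vecMul_one, Matrix.vecMul_smul, Matrix.vecMul_smul,
    Matrix.vecMul_vecMulVec, h, zero_smul, smul_zero, smul_zero, sub_zero]

/-- **The row `v̄ᵀHc` is a `(−1)`-eigenrow of `r_v`** (`q(v) ≠ 0`). [cite: Deligne1979ShimuraVarieties, Prop. 2.3.10 (PDF p. 32)] -/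
theorem star_vecMul_vecMul_reflH (hv : formH Hc v ≠ 0) : (star v ᵥ* Hc) ᵥ* reflH Hc v = -(star v ᵥ* Hc) := by
  rw [reflH, projH, Matrix.vecMul_sub, Matrix.vecMul_one, Matrix.vecMul_smul, Matrix.vecMul_smul,
    Matrix.vecMul_vecMulVec, star_vecMul_dotProduct, smul_smul, smul_smul, mul_assoc, inv_mul_cancel₀ hv, mul_one,
    two_smul]
  abel

/-! #### Positivity of `Hc·r_v` from the signature -/

/-- **`(r_v y)ᴴ Hc y = q(y⊥) − |a|² q(v)`** for the decomposition `y = a v + y⊥`, `a = v̄ᵀHc y / q(v)`, `y⊥ ⊥ v` (hermitian `Hc`, `q(v) ≠ 0`).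
[cite: Deligne1979ShimuraVarieties, Prop. 2.3.10 (PDF p. 32)] [cite: Milne2005ShimuraVarieties, §6 pp. 68–69] -/
theorem star_reflH_mulVec_dotProduct_eq (hH : Hcᴴ = Hc) (hv : formH Hc v ≠ 0) (y : m → ℂ) :
    star (reflH Hc v *ᵥ y) ⬝ᵥ (Hc *ᵥ y) =
      star (y - ((formH Hc v)⁻¹ * (star v ⬝ᵥ (Hc *ᵥ y))) • v) ⬝ᵥ
          (Hc *ᵥ (y - ((formH Hc v)⁻¹ * (star v ⬝ᵥ (Hc *ᵥ y))) • v)) -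
        (conj ((formH Hc v)⁻¹ * (star v ⬝ᵥ (Hc *ᵥ y))) * ((formH Hc v)⁻¹ * (star v ⬝ᵥ (Hc *ᵥ y)))) * formH Hc v := by
  set a : ℂ := (formH Hc v)⁻¹ * (star v ⬝ᵥ (Hc *ᵥ y)) with ha
  set y' : m → ℂ := y - a • v with hy'
  -- `v̄ᵀ Hc y⊥ = 0`
  have hperp : star v ⬝ᵥ (Hc *ᵥ y') = 0 := by
    rw [hy', Matrix.mulVec_sub, Matrix.mulVec_smul, dotProduct_sub, dotProduct_smul, smul_eq_mul, ← formH, ha,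
      mul_comm (formH Hc v)⁻¹, inv_mul_cancel_right₀ hv, sub_self]
  have hperp' : star y' ⬝ᵥ (Hc *ᵥ v) = 0 := by
    rw [← conj_star_dotProduct_mulVec hH, hperp, map_zero]
  have hrefl : reflH Hc v *ᵥ y = y' - a • v := by
    rw [reflH_mulVec, ← ha, mul_smul, two_smul, hy']
    abel
  have hy : y = y' + a • v := by rw [hy']; abel
  calc star (reflH Hc v *ᵥ y) ⬝ᵥ (Hc *ᵥ y)
      = star (y' - a • v) ⬝ᵥ (Hc *ᵥ (y' + a • v)) := by rw [hrefl, ← hy]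
    _ = star y' ⬝ᵥ (Hc *ᵥ y') - conj a * a * formH Hc v := by
        rw [star_sub, star_smul, Matrix.mulVec_add, Matrix.mulVec_smul, sub_dotProduct, dotProduct_add, dotProduct_add,
          smul_dotProduct, smul_dotProduct, dotProduct_smul, dotProduct_smul, hperp, hperp', Complex.star_def]
        simp only [formH, smul_eq_mul, mul_zero, add_zero]
        ring

/-- **Positivity of `Hc·r_v` from the signature.**  If `Re q(v) < 0` (`v` negative) and `Hc` is positive on the `Hc`-orthogonal of `v`
(`hsig`: signature `(n−1, 1)`), then `(r_v y)ᴴ Hc y > 0` for every `y ≠ 0` — the hermitian form `Hc·r_v` is positive definite.  (Rank-3 twin: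
★ `star_reflFrame_mulVec_dotProduct_pos`, there via `U(2,1)`-transitivity; here directly on `y = a v + y⊥`.)
[cite: Deligne1979ShimuraVarieties, Prop. 2.3.10 (PDF p. 32)] [cite: Milne2005ShimuraVarieties, §6 pp. 68–69 («ψ(u, Ju) definite»)] -/
theorem star_reflH_mulVec_dotProduct_pos (hH : Hcᴴ = Hc) (hv : v ∈ negCone Hc)
    (hsig : ∀ y : m → ℂ, star v ⬝ᵥ (Hc *ᵥ y) = 0 → y ≠ 0 → 0 < (star y ⬝ᵥ (Hc *ᵥ y)).re)
    {y : m → ℂ} (hy : y ≠ 0) : 0 < star (reflH Hc v *ᵥ y) ⬝ᵥ (Hc *ᵥ y) := by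
  have hq : formH Hc v ≠ 0 := formH_ne_zero_of_mem_negCone Hc hv
  have hqre : (formH Hc v).re < 0 := formH_re_neg_of_mem_negCone Hc hv
  set a : ℂ := (formH Hc v)⁻¹ * (star v ⬝ᵥ (Hc *ᵥ y)) with ha
  set y' : m → ℂ := y - a • v with hy'
  have hperp : star v ⬝ᵥ (Hc *ᵥ y') = 0 := by
    rw [hy', Matrix.mulVec_sub, Matrix.mulVec_smul, dotProduct_sub, dotProduct_smul, smul_eq_mul, ← formH, ha,
      mul_comm (formH Hc v)⁻¹, inv_mul_cancel_right₀ hq, sub_self]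
  have heq := star_reflH_mulVec_dotProduct_eq Hc hH hq y
  rw [← ha, ← hy'] at heq
  -- both summands are real; real parts: `Re q(y') ≥ 0`, `−|a|² Re q(v) ≥ 0`, not both zero
  have him₁ : (star y' ⬝ᵥ (Hc *ᵥ y')).im = 0 := formH_im hH y'
  have haa : conj a * a = ((Complex.normSq a : ℝ) : ℂ) := (Complex.normSq_eq_conj_mul_self).symm
  rw [heq, haa]
  refine Complex.pos_iff.2 ⟨?_, ?_⟩
  · rw [Complex.sub_re, Complex.re_ofReal_mul]
    by_cases hy'0 : y' = 0
    · -- then `y = a v` with `a ≠ 0`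
      have ha0 : a ≠ 0 := by
        intro ha0
        apply hy
        have : y = y' + a • v := by rw [hy']; abel
        rw [this, hy'0, ha0, zero_smul, add_zero]
      have hn : 0 < Complex.normSq a := Complex.normSq_pos.2 ha0
      rw [hy'0, Matrix.mulVec_zero, dotProduct_zero, Complex.zero_re, zero_sub]
      nlinarith
    · have h1 : 0 < (star y' ⬝ᵥ (Hc *ᵥ y')).re := hsig y' hperp hy'0
      have h2 : Complex.normSq a * (formH Hc v).re ≤ 0 :=
        mul_nonpos_of_nonneg_of_nonpos (Complex.normSq_nonneg a) hqre.le
      linarith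
  · rw [Complex.sub_im, Complex.im_ofReal_mul, him₁, formH_im hH, mul_zero, sub_zero]

/-- `(r_v y)ᴴ Hc y ≥ 0` (same hypotheses, any `y`). [cite: Deligne1979ShimuraVarieties, Prop. 2.3.10 (PDF p. 32)] -/
theorem star_reflH_mulVec_dotProduct_nonneg (hH : Hcᴴ = Hc) (hv : v ∈ negCone Hc)
    (hsig : ∀ y : m → ℂ, star v ⬝ᵥ (Hc *ᵥ y) = 0 → y ≠ 0 → 0 < (star y ⬝ᵥ (Hc *ᵥ y)).re)
    (y : m → ℂ) : 0 ≤ star (reflH Hc v *ᵥ y) ⬝ᵥ (Hc *ᵥ y) := by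
  by_cases hy : y = 0
  · rw [hy, Matrix.mulVec_zero, Matrix.mulVec_zero, dotProduct_zero]
  · exact (star_reflH_mulVec_dotProduct_pos Hc hH hv hsig hy).le

end Reflection

end AuxV

end UnitaryCurve

end Literature.AlgebraicGeometry.ShimuraVarieties

end
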